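import Summits.CriticalPhenomena.PercolationContinuityZ3.Theorems.PercThresholdOneFragileWeavingGiantExistsDefs

/-!
# `FragileWeavingGiantExists` (stmt-CriticalPhenomena-5266) — the routing pattern, `3`-adic digits and blocks

Part of the proof of support item `FragileWeavingGiantExists` of route `PercThresholdOne` by the stationary
hierarchical spanning tree of `ℤ³` (see `PercThresholdOneFragileWeavingGiantExistsDefs.lean` for the construction and the overview).
-/

noncomputable section

namespace Summit.CriticalPhenomena.PercolationContinuityZ3.Theorems.FragileGiant

open MeasureTheory
open scoped ENNReal
open Literature.Probability.Percolation Literature.Probability.LatticeModels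
open Literature.Probability.Percolation.DCT16

/-- Progress and validity of the routing: away from the target the step is valid and the potential drops. -/
theorem qstep_valid : ∀ (s : P) (t : K4), s ≠ pos t → valid s (qstep s t) = true := by decide

/-- The routing potential strictly decreases along the routing. -/
theorem qdist_qnext_lt : ∀ (s : P) (t : K4), s ≠ pos t → qdist (qnext s t) t < qdist s t := by decide

/-- The leaf `b0` is never a routing successor. -/
theorem qnext_ne_b0 : ∀ (s : P) (t : K4), s ≠ pos t → qnext s t ≠ b0 := by decide

/-- `b0` is not a corner position. -/
theorem b0_ne_pos : ∀ t : K4, b0 ≠ pos t := by decide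

/-- `b0` is synchronising. -/
theorem isSync_b0 : isSync b0 = true := by decide

/-- The positions `syncNeg i` are synchronising. -/
theorem isSync_syncNeg : ∀ i : Fin 3, isSync (syncNeg i) = true := by decide

/-- At a synchronising position the routing step is the step toward the centre, whatever the target. -/
theorem qstep_of_isSync : ∀ (s : P), isSync s = true → ∀ t : K4, qstep s t = toCenterDir s := by decide

/-- A synchronising position is not a corner position. -/
theorem ne_pos_of_isSync : ∀ (s : P), isSync s = true → ∀ t : K4, s ≠ pos t := by decide

/-- At a synchronising position the exit-type recursion is constant, equal to `syncVal`. -/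
theorem nextType_of_isSync (s : P) (hs : isSync s = true) (t : K4) : nextType s t = syncVal s := by
  simp [nextType, ne_pos_of_isSync s hs t, qstep_of_isSync s hs t, syncVal]

/-- The synchronised value at `syncNeg i` is the `i`-min corner. -/
theorem syncVal_syncNeg : ∀ i : Fin 3, syncVal (syncNeg i) = some i := by decide

/-- The synchronised value at `b0` is the all-max corner. -/
theorem syncVal_b0 : syncVal b0 = none := by decide

/-- The recursion fixes the type at the corner position: `nextType (pos t) t = t`. -/
theorem nextType_pos (t : K4) : nextType (pos t) t = t := by simp [nextType]

/-- Away from the corner position the new type is the corner of the routing step. -/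
theorem nextType_of_ne {a : P} {t : K4} (h : a ≠ pos t) : nextType a t = cornerOf (qstep a t) := by
  simp [nextType, h]

/-- Coordinates of corner positions: `pos t i = 0` iff `t = some i`, else `2`. -/
theorem pos_apply (t : K4) (i : Fin 3) : pos t i = if t = some i then 0 else 2 := rfl

/-- The value of a valid step: the moved coordinate changes by one (as natural numbers), the others not. -/
theorem movePos_val_of_valid : ∀ (s : P) (d : Dir), valid s d = true →
    ((movePos s d (d.1) : ℕ) = if d.2 then (s d.1 : ℕ) + 1 else (s d.1 : ℕ) - 1) ∧
    ∀ j, j ≠ d.1 → movePos s d j = s j := by decide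

/-- A valid negative step starts from a nonzero coordinate, a valid positive one from a coordinate `≠ 2`. -/
theorem valid_iff (s : P) (d : Dir) :
    valid s d = true ↔ (if d.2 then s d.1 ≠ 2 else s d.1 ≠ 0) := by
  unfold valid; split <;> simp

/-- `0 < 3^n` in `ℤ`. -/
theorem three_pow_pos (n : ℕ) : (0 : ℤ) < 3 ^ n := by positivity

/-- Value of a digit as an integer. -/
theorem zdigit_val (y : ℤ) (m : ℕ) : ((zdigit y m : ℕ) : ℤ) = (y / 3 ^ m) % 3 := by
  simp only [zdigit]
  rw [Int.toNat_of_nonneg (Int.emod_nonneg _ (by norm_num))]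

/-- Shifting by a small amount inside a residue class does not change the quotient. -/
theorem ediv_emod_add_of_range {y K δ : ℤ} (hK : 0 < K) (h0 : 0 ≤ y % K + δ) (h1 : y % K + δ < K) :
    (y + δ) / K = y / K ∧ (y + δ) % K = y % K + δ := by
  refine (Int.ediv_emod_unique hK).2 ⟨?_, h0, h1⟩
  have := Int.emod_add_mul_ediv y K
  linarith

/-- The base-`3` splitting of a residue: `y mod 3^(n+1) = y mod 3^n + ((y / 3^n) mod 3) · 3^n`. -/
theorem emod_pow_succ (y : ℤ) (n : ℕ) :
    y % 3 ^ (n + 1) = y % 3 ^ n + (y / 3 ^ n % 3) * 3 ^ n := by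
  have hA : y / 3 ^ n / 3 = y / 3 ^ (n + 1) := by
    rw [Int.ediv_ediv_of_nonneg (three_pow_pos n).le, pow_succ]
  rw [Int.emod_def, Int.emod_def, Int.emod_def, hA, pow_succ]
  ring

/-- Digits only see the residue modulo `3^(m+1)`. -/
theorem zdigit_add_mul (y k : ℤ) (m : ℕ) : zdigit (y + k * 3 ^ (m + 1)) m = zdigit y m := by
  apply Fin.ext
  have h1 := zdigit_val (y + k * 3 ^ (m + 1)) m
  have h2 := zdigit_val y m
  have : (y + k * 3 ^ (m + 1)) / 3 ^ m = y / 3 ^ m + k * 3 := by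
    rw [show k * (3 : ℤ) ^ (m + 1) = (k * 3) * 3 ^ m by ring,
      Int.add_mul_ediv_right _ _ (three_pow_pos m).ne']
  rw [this, Int.add_mul_emod_self_right] at h1
  exact_mod_cast h1.trans h2.symm

/-- Partial sums are nonnegative and `< 3^n`. -/
theorem psum_nonneg (ω : Ω) (n : ℕ) (i : Fin 3) : 0 ≤ psum ω n i := by
  unfold psum
  exact Finset.sum_nonneg fun m _ => by positivity

/-- Partial sums are `< 3^n`. -/
theorem psum_lt (ω : Ω) (n : ℕ) (i : Fin 3) : psum ω n i < 3 ^ n := by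
  induction n with
  | zero => simp [psum]
  | succ n ih =>
    have hs : psum ω (n + 1) i = psum ω n i + ((ω n i : ℕ) : ℤ) * 3 ^ n := by
      simp [psum, Finset.sum_range_succ]
    have hd : ((ω n i : ℕ) : ℤ) ≤ 2 := by
      have := (ω n i).isLt; omega
    rw [hs, pow_succ]
    nlinarith [three_pow_pos n]

/-- One more term of the partial sum. -/
theorem psum_succ (ω : Ω) (n : ℕ) (i : Fin 3) :
    psum ω (n + 1) i = psum ω n i + ((ω n i : ℕ) : ℤ) * 3 ^ n := by
  simp [psum, Finset.sum_range_succ]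

/-- Later partial sums agree with earlier ones modulo `3^n`. -/
theorem psum_emod (ω : Ω) {n N : ℕ} (h : n ≤ N) (i : Fin 3) : psum ω N i % 3 ^ n = psum ω n i := by
  induction N, h using Nat.le_induction with
  | base => exact Int.emod_eq_of_lt (psum_nonneg ω n i) (psum_lt ω n i)
  | succ N hN ih =>
    rw [psum_succ, show ((ω N i : ℕ) : ℤ) * 3 ^ N = (((ω N i : ℕ) : ℤ) * 3 ^ (N - n)) * 3 ^ n by
      rw [mul_assoc, ← pow_add, Nat.sub_add_cancel hN], Int.add_mul_emod_self_right, ih]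

/-- A later partial sum differs from an earlier one by a multiple of `3^n`. -/
theorem psum_eq_add_mul (ω : Ω) {n N : ℕ} (h : n ≤ N) (i : Fin 3) :
    psum ω N i = psum ω n i + (psum ω N i / 3 ^ n) * 3 ^ n := by
  have h1 := Int.emod_add_mul_ediv (psum ω N i) (3 ^ n)
  rw [psum_emod ω h i] at h1
  linarith

/-- The relative position does not depend on which partial sum (of index `≥ n`) is used. -/
theorem rel_eq_emod (ω : Ω) {n N : ℕ} (h : n ≤ N) (x : V3) (i : Fin 3) :
    rel ω n x i = (x i + psum ω N i) % 3 ^ n := by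
  unfold rel
  rw [psum_eq_add_mul ω h i, ← add_assoc, Int.add_mul_emod_self_right]

/-- Bounds on the relative position. -/
theorem rel_nonneg (ω : Ω) (n : ℕ) (x : V3) (i : Fin 3) : 0 ≤ rel ω n x i :=
  Int.emod_nonneg _ (three_pow_pos n).ne'

/-- Bounds on the relative position. -/
theorem rel_lt (ω : Ω) (n : ℕ) (x : V3) (i : Fin 3) : rel ω n x i < 3 ^ n :=
  Int.emod_lt_of_pos _ (three_pow_pos n)

/-- Value of a digit as an integer. -/
theorem digit_val (ω : Ω) (x : V3) (m : ℕ) (i : Fin 3) :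
    ((digit ω x m i : ℕ) : ℤ) = (x i + psum ω (m + 1) i) / 3 ^ m % 3 :=
  zdigit_val _ _

/-- **Digit recursion for relative positions**: `rel_{m+1} = rel_m + digit_m · 3^m`. -/
theorem rel_succ (ω : Ω) (m : ℕ) (x : V3) (i : Fin 3) :
    rel ω (m + 1) x i = rel ω m x i + ((digit ω x m i : ℕ) : ℤ) * 3 ^ m := by
  rw [digit_val, rel_eq_emod ω (Nat.le_succ m) x i]
  exact emod_pow_succ _ _

/-- The digit and the lower relative position are quotient and remainder of `rel_{m+1}` by `3^m`. -/
theorem rel_succ_ediv_emod (ω : Ω) (m : ℕ) (x : V3) (i : Fin 3) :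
    rel ω (m + 1) x i / 3 ^ m = ((digit ω x m i : ℕ) : ℤ) ∧ rel ω (m + 1) x i % 3 ^ m = rel ω m x i :=
  (Int.ediv_emod_unique (three_pow_pos m)).2
    ⟨by rw [rel_succ]; ring, rel_nonneg ω m x i, rel_lt ω m x i⟩

/-- Uniqueness of the splitting `rel_{m+1} = r + d · 3^m` with `0 ≤ r < 3^m`. -/
theorem rel_digit_unique (ω : Ω) (m : ℕ) (x : V3) (i : Fin 3) {r d : ℤ} (hr0 : 0 ≤ r) (hr : r < 3 ^ m)
    (h : rel ω (m + 1) x i = r + d * 3 ^ m) :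
    rel ω m x i = r ∧ ((digit ω x m i : ℕ) : ℤ) = d := by
  have hu := (Int.ediv_emod_unique (a := rel ω (m + 1) x i) (q := d) (r := r) (three_pow_pos m)).2
    ⟨by rw [h]; ring, hr0, hr⟩
  have h2 := rel_succ_ediv_emod ω m x i
  exact ⟨h2.2.symm.trans hu.2, h2.1.symm.trans hu.1⟩

/-- `rel` is monotone in the level (the min corner of the block recedes). -/
theorem rel_le_rel_succ (ω : Ω) (m : ℕ) (x : V3) (i : Fin 3) : rel ω m x i ≤ rel ω (m + 1) x i := by
  rw [rel_succ]
  have : (0 : ℤ) ≤ ((digit ω x m i : ℕ) : ℤ) := by positivity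
  nlinarith [three_pow_pos m]

/-- `rel` is monotone in the level. -/
theorem rel_mono (ω : Ω) {m n : ℕ} (h : m ≤ n) (x : V3) (i : Fin 3) : rel ω m x i ≤ rel ω n x i := by
  induction n, h using Nat.le_induction with
  | base => exact le_rfl
  | succ n _ ih => exact ih.trans (rel_le_rel_succ ω n x i)

/-- A nonzero digit at level `m` pushes the min corner at least `3^m` below. -/
theorem pow_le_rel_of_digit_ne_zero (ω : Ω) {m n : ℕ} (h : m < n) (x : V3) (i : Fin 3)
    (hd : digit ω x m i ≠ 0) : 3 ^ m ≤ rel ω n x i := by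
  have h1 : rel ω (m + 1) x i ≥ 3 ^ m := by
    rw [rel_succ]
    have hd1 : (1 : ℤ) ≤ ((digit ω x m i : ℕ) : ℤ) := by
      have : (digit ω x m i : ℕ) ≠ 0 := fun h0 => hd (Fin.ext h0)
      omega
    nlinarith [three_pow_pos m, rel_nonneg ω m x i]
  exact h1.le.trans (rel_mono ω h x i)

/-- A digit different from `2` at level `m` keeps the max corner at least `3^m` above. -/
theorem rel_add_pow_le_of_digit_ne_two (ω : Ω) {m n : ℕ} (h : m < n) (x : V3) (i : Fin 3)
    (hd : digit ω x m i ≠ 2) : rel ω n x i + 3 ^ m ≤ 3 ^ n - 1 := by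
  induction n, h using Nat.le_induction with
  | base =>
    rw [rel_succ]
    have hd1 : ((digit ω x m i : ℕ) : ℤ) ≤ 1 := by
      have h3 := (digit ω x m i).isLt
      have : (digit ω x m i : ℕ) ≠ 2 := fun h0 => hd (Fin.ext h0)
      omega
    have := rel_lt ω m x i
    rw [pow_succ]; nlinarith [three_pow_pos m]
  | succ n hmn ih =>
    rw [rel_succ ω n, pow_succ]
    have hd2 : ((digit ω x n i : ℕ) : ℤ) ≤ 2 := by have := (digit ω x n i).isLt; omega
    nlinarith [three_pow_pos n]

/-- The offsets form a `3`-adic hierarchical decomposition. -/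
theorem isHierOffset_offs (ω : Ω) : IsHierOffset 3 (offs ω) := by
  intro n i
  refine ⟨Int.emod_nonneg _ (by exact_mod_cast (three_pow_pos n).ne'),
    by exact_mod_cast Int.emod_lt_of_pos _ (three_pow_pos n), ?_⟩
  show (-psum ω (n + 1) i) % 3 ^ (n + 1) % (3 : ℤ) ^ n = (-psum ω n i) % 3 ^ n
  rw [Int.emod_emod_of_dvd _ (pow_dvd_pow 3 (Nat.le_succ n)), psum_succ, neg_add, neg_mul_eq_neg_mul,
    Int.add_mul_emod_self_right]

/-- `1 ≤ 3` (the side length hypothesis of the block API). -/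
theorem one_le_three : 1 ≤ 3 := by norm_num

/-- **Membership in a block**: same quotient of `x + S_n` by `3^n` in every coordinate. -/
theorem mem_blk_iff (ω : Ω) {n : ℕ} {x y : V3} :
    y ∈ blk ω n x ↔ ∀ i, (y i + psum ω n i) / 3 ^ n = (x i + psum ω n i) / 3 ^ n := by
  unfold blk
  rw [mem_block_iff one_le_three]
  have key : ∀ z : V3, ∀ i, blockIdx 3 (offs ω) n z i =
      (z i + psum ω n i) / 3 ^ n + (-psum ω n i) / 3 ^ n := by
    intro z i
    simp only [blockIdx, offs]
    have h1 := Int.emod_add_mul_ediv (-psum ω n i) (3 ^ n)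
    have : z i - -psum ω n i % 3 ^ n = (z i + psum ω n i) + ((-psum ω n i) / 3 ^ n) * 3 ^ n := by
      linarith
    rw [show ((3 : ℕ) : ℤ) ^ n = (3 : ℤ) ^ n by norm_num, this,
      Int.add_mul_ediv_right _ _ (three_pow_pos n).ne']
  constructor
  · intro h i
    have := congr_fun h i
    rw [key, key] at this
    linarith
  · intro h
    funext i
    rw [key, key, h i]

/-- Membership in a block, tested with any later partial sum. -/
theorem mem_blk_iff' (ω : Ω) {n N : ℕ} (hN : n ≤ N) {x y : V3} :
    y ∈ blk ω n x ↔ ∀ i, (y i + psum ω N i) / 3 ^ n = (x i + psum ω N i) / 3 ^ n := by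
  rw [mem_blk_iff]
  refine forall_congr' fun i => ?_
  rw [psum_eq_add_mul ω hN i, ← add_assoc, ← add_assoc, Int.add_mul_ediv_right _ _ (three_pow_pos n).ne',
    Int.add_mul_ediv_right _ _ (three_pow_pos n).ne']
  constructor
  · intro h; rw [h]
  · intro h; linarith

/-- `x ∈ B_n(x)`. -/
theorem mem_blk_self (ω : Ω) (n : ℕ) (x : V3) : x ∈ blk ω n x := (mem_blk_iff ω).2 fun _ => rfl

/-- Blocks of one level containing a common point are equal. -/
theorem blk_eq_of_mem (ω : Ω) {n : ℕ} {x y : V3} (h : y ∈ blk ω n x) : blk ω n y = blk ω n x :=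
  (block_eq_iff_mem one_le_three (offs ω)).2 h

/-- Transitivity of block membership. -/
theorem mem_blk_trans (ω : Ω) {n : ℕ} {x y z : V3} (hy : y ∈ blk ω n x) (hz : z ∈ blk ω n y) :
    z ∈ blk ω n x := by
  rwa [blk_eq_of_mem ω hy] at hz

/-- Nestedness of blocks. -/
theorem blk_mono (ω : Ω) {m n : ℕ} (h : m ≤ n) (x : V3) : blk ω m x ⊆ blk ω n x :=
  block_mono one_le_three (offs ω) (isHierOffset_offs ω) h x

/-- Points of a common block have the same min corner: `y - rel_n(y) = x - rel_n(x)`. -/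
theorem sub_rel_eq_of_mem_blk (ω : Ω) {n : ℕ} {x y : V3} (h : y ∈ blk ω n x) (i : Fin 3) :
    y i - rel ω n y i = x i - rel ω n x i := by
  rw [mem_blk_iff] at h
  simp only [rel]
  have h1 := Int.emod_add_mul_ediv (y i + psum ω n i) (3 ^ n)
  have h2 := Int.emod_add_mul_ediv (x i + psum ω n i) (3 ^ n)
  rw [h i] at h1
  linarith

/-- **Sub-blocks**: inside a common `(m+1)`-block, two points share the `m`-block iff their level-`m`
digits agree. -/
theorem mem_blk_iff_digit_eq (ω : Ω) {m : ℕ} {x y : V3} (h : y ∈ blk ω (m + 1) x) :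
    y ∈ blk ω m x ↔ digit ω y m = digit ω x m := by
  rw [mem_blk_iff' ω (Nat.le_succ m)]
  rw [mem_blk_iff] at h
  have key : ∀ z : V3, ∀ i, (z i + psum ω (m + 1) i) / 3 ^ m =
      ((digit ω z m i : ℕ) : ℤ) + 3 * ((z i + psum ω (m + 1) i) / 3 ^ (m + 1)) := by
    intro z i
    rw [digit_val, pow_succ, ← Int.ediv_ediv_of_nonneg (three_pow_pos m).le]
    have := Int.emod_add_mul_ediv ((z i + psum ω (m + 1) i) / 3 ^ m) 3
    linarith
  constructor
  · intro hq
    funext i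
    apply Fin.ext
    have := key y i
    rw [hq i, key x i, h i] at this
    exact_mod_cast (by linarith : ((digit ω y m i : ℕ) : ℤ) = ((digit ω x m i : ℕ) : ℤ))
  · intro hd i
    rw [key, key, h i, hd]

/-- Points of a common `n`-block have the same digits at all levels `≥ n`. -/
theorem digit_eq_of_mem_blk (ω : Ω) {n : ℕ} {x y : V3} (h : y ∈ blk ω n x) {m : ℕ} (hm : n ≤ m) :
    digit ω y m = digit ω x m :=
  (mem_blk_iff_digit_eq ω (blk_mono ω (Nat.le_succ_of_le hm) x h)).1 (blk_mono ω hm x h)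

/-- A step `+eᵢ` that does not leave the residue range stays in the block and shifts `rel` by one. -/
theorem add_single_mem_blk (ω : Ω) {n : ℕ} {x : V3} {i : Fin 3} (h : rel ω n x i + 1 < 3 ^ n) :
    x + Pi.single i 1 ∈ blk ω n x ∧ rel ω n (x + Pi.single i 1) i = rel ω n x i + 1 ∧
      ∀ j, j ≠ i → rel ω n (x + Pi.single i 1) j = rel ω n x j := by
  have key := ediv_emod_add_of_range (y := x i + psum ω n i) (δ := 1) (three_pow_pos n)
    (by have := rel_nonneg ω n x i; simp only [rel] at this; linarith) (by simp only [rel] at h; linarith)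
  refine ⟨(mem_blk_iff ω).2 fun j => ?_, ?_, fun j hj => ?_⟩
  · rcases eq_or_ne j i with rfl | hj
    · simp only [Pi.add_apply, Pi.single_eq_same]
      rw [show x j + 1 + psum ω n j = x j + psum ω n j + 1 by ring]
      exact key.1
    · simp [Pi.single_eq_of_ne hj]
  · simp only [rel, Pi.add_apply, Pi.single_eq_same]
    rw [show x i + 1 + psum ω n i = x i + psum ω n i + 1 by ring]
    exact key.2
  · simp [rel, Pi.single_eq_of_ne hj]

/-- A step `-eᵢ` that does not leave the residue range stays in the block and shifts `rel` by minus one. -/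
theorem sub_single_mem_blk (ω : Ω) {n : ℕ} {x : V3} {i : Fin 3} (h : 1 ≤ rel ω n x i) :
    x - Pi.single i 1 ∈ blk ω n x ∧ rel ω n (x - Pi.single i 1) i = rel ω n x i - 1 ∧
      ∀ j, j ≠ i → rel ω n (x - Pi.single i 1) j = rel ω n x j := by
  have key := ediv_emod_add_of_range (y := x i + psum ω n i) (δ := -1) (three_pow_pos n)
    (by simp only [rel] at h; linarith) (by have := rel_lt ω n x i; simp only [rel] at this; linarith)
  refine ⟨(mem_blk_iff ω).2 fun j => ?_, ?_, fun j hj => ?_⟩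
  · rcases eq_or_ne j i with rfl | hj
    · simp only [Pi.sub_apply, Pi.single_eq_same]
      rw [show x j - 1 + psum ω n j = x j + psum ω n j + -1 by ring]
      exact key.1
    · simp [Pi.single_eq_of_ne hj]
  · simp only [rel, Pi.sub_apply, Pi.single_eq_same]
    rw [show x i - 1 + psum ω n i = x i + psum ω n i + -1 by ring]
    rw [key.2]; ring
  · simp [rel, Pi.single_eq_of_ne hj]

end Summit.CriticalPhenomena.PercolationContinuityZ3.Theorems.FragileGiant
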